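import Mathlib

/-!
# `LacunarySymmetroid.MatrixDescartes` (stmt-ValiantsHypothesis-18050) — line «negsquares» ported: THE COMMUTING SECTOR of the
# `κ = 1` law — the critical polynomial, the kink budget CKB, and PROP. E «CKB ⇒ COMM-L1» IN KERNEL

Port (val-lit merged desk, b71 (B) port pool; porter val-port-1 g2; text = val-idea-6 g8's, VERBATIM, credited) of the section
«The commuting sector: the critical polynomial and the kink budget» + «Prop. E in kernel (v1.3)» (lines 492–706) of the crux
workfile `Cruxes/MatrixDescartes/Lines/negsquares_tropical.lean` @a5842f280434 (val-idea-6 g8, memo `Lines/negsquares-kink.md`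
v1.1; kernel-checked there, 0 sorry).  Same namespace as port-3 g0's R1 port `…NegSquaresExtremeExponent`
(`…Theorems.LacunarySymmetroidMatrixDescartes.NegSquaresTropical`).  Mathlib only.

For POSITIVE DIAGONAL (commuting) letters `P l = diagonal (p l)` at strictly increasing exponents `d l` and one subtracted
square `X^e • 11ᵀ`, the `κ = 1` determinant is `commDet = Π_i q i − X^e · Σ_i Π_{j≠i} q j` with letter polynomials
`q i = letterPoly d p i = Σ_l p l i X^{d l}`; its positive zeros are governed by the CRITICAL POLYNOMIAL
`critPoly = Σ_i r i · Π_{j≠i} (q j)²`, `r i = tiltPoly = X (q i)' − e (q i)` (`tiltPoly_eq`).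

* Definitions (g8, verbatim): `letterPoly`, `tiltPoly`, `critPoly`, `commDet`, `posRoots` (number of DISTINCT positive
  roots), `CommCriticalBudget m K` («CKB»: `Z₊(critPoly) ≤ 2(m−1)(K−1)+1` — a theorem in the tropical model (memo Thm A),
  a LOCATED CONJECTURE in the honest one, OPEN from `(2,3)` structurally / `(3,3)` numerically; typed as a `Prop`, used
  below ONLY as a hypothesis), `CommOneLawSharp m K` («COMM-L1»: `Z₊(commDet) ≤ 2(m−1)(K−1)+2`, the located sharp one-law on
  the commuting sector; a `Prop`).
* `commL1_eq_two_budget`, `tiltPoly_eq`, `commCriticalBudget_zero` (`m = 0`), `sum_coprod_mul_prod`, `sum_coprod_wronskian`,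
  `X_mul_C_mul_X_pow_pred`.
* ★ `X_mul_wronskian_commDet` — **Prop. E, algebraic half**: `X·(N'·Πq − N·(Πq)') = X^e·S` (an identity in `ℝ[X]`).
* ★ `posRoots_commDet_le_succ` — **Prop. E, analytic half**: if `Πq > 0` on `t > 0` then `Z₊(N) ≤ Z₊(S) + 1` (Rolle on
  `N/Πq` between consecutive positive zeros, incl. the degenerate case `S = 0`); `prod_letterPoly_eval_pos`.
* ★★ `commOneLawSharp_of_commCriticalBudget (hK : 0 < K) : CommCriticalBudget m K → CommOneLawSharp m K` — CKB ⇒ COMM-L1; so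
  the located `(3,3)` target «COMM ≤ 10» is, in kernel, a consequence of the real-root-counting statement CKB(3,3).

Honest framing.  Helper port (`--supports stmt-ValiantsHypothesis-18050 --as helper`); definition lane (seven `def`s, two of
them `Prop`s that are LOCATED CONJECTURES of the seat val-idea-6, never asserted here).  Nothing bears on the negsquares LAW,
on `OneLawSharp`, on the crux `…Theses.LacunarySymmetroid.MatrixDescartes` (18050), on Conjecture B, or on `VP ≠ VNP`
(NOT proved).  [this line's workfile; folklore (Rolle, Wronskian identity)]
-/

-- `Summit.ValiantsHypothesis.ValiantsHypothesis.…` is the tree's mandated single-conjunct layout (Sub = Summit).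
set_option linter.dupNamespace false

namespace Summit.ValiantsHypothesis.ValiantsHypothesis.Theorems.LacunarySymmetroidMatrixDescartes.NegSquaresTropical

open Polynomial Matrix Finset
open scoped BigOperators

/-! ## The commuting sector: the critical polynomial and the kink budget (val-idea-6 g8, memo `negsquares-kink.md`) -/

section Commuting

variable {m K : ℕ}

/-- The `i`-th letter polynomial `q i = Σ_l p l i · X^{d l}` of a diagonal (commuting) letter family
`P l = diagonal (p l)`. -/
noncomputable def letterPoly (d : Fin K → ℕ) (p : Fin K → Fin m → ℝ) (i : Fin m) : ℝ[X] :=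
  ∑ l, C (p l i) * X ^ d l

/-- The tilt `r i = Σ_l (d l − e) · p l i · X^{d l}` (REAL coefficient `d l − e`, no natural subtraction);
`tiltPoly_eq`: `r i = X · (q i)' − e · q i`. -/
noncomputable def tiltPoly (d : Fin K → ℕ) (e : ℕ) (p : Fin K → Fin m → ℝ) (i : Fin m) : ℝ[X] :=
  ∑ l, C (((d l : ℝ) - e) * p l i) * X ^ d l

/-- The critical polynomial `S = Σ_i r i · Π_{j ≠ i} (q j)²`: `sign σ'(log t) = −sign S(t)` for `σ = Σ_i X^e / q i`
(memo §0), so the distinct positive roots of `S` are the critical points of `σ`. -/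
noncomputable def critPoly (d : Fin K → ℕ) (e : ℕ) (p : Fin K → Fin m → ℝ) : ℝ[X] :=
  ∑ i, tiltPoly d e p i * ∏ j ∈ Finset.univ.erase i, letterPoly d p j ^ 2

/-- The commuting `κ = 1` determinant `N = Π_i q i − X^e · Σ_i Π_{j ≠ i} q j`
(`= det (diagonal q − X^e • 11ᵀ)` by the matrix-determinant lemma; `w` absorbed into the letters). -/
noncomputable def commDet (d : Fin K → ℕ) (e : ℕ) (p : Fin K → Fin m → ℝ) : ℝ[X] :=
  ∏ i, letterPoly d p i - X ^ e * ∑ i, ∏ j ∈ Finset.univ.erase i, letterPoly d p j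

/-- Number of DISTINCT positive roots — the count used in `OneLawSharp`. -/
noncomputable def posRoots (f : ℝ[X]) : ℕ := (f.roots.toFinset.filter (fun t => 0 < t)).card

/-- **CKB(m,K) — the commuting critical budget (located conjecture; memo `negsquares-kink.md` §1, §6).**
For strictly increasing natural exponents and POSITIVE diagonal letters, the critical polynomial has at most
`2(m−1)(K−1) + 1` distinct positive roots — i.e. `σ = Σ_i X^e/q i` has at most `(m−1)(K−1) + 1` local maxima
(«kink budget»: a theorem in the tropical model, memo Thm A; proved for `K ≤ 2` by degree, memo §4; OPEN from
`(m,K) = (2,3)` on as a structural statement and from `(3,3)` on even numerically-vs-Descartes: memo §6 table).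
`CommCriticalBudget m K → CommOneLawSharp m K` is memo Prop. E (Rolle; prover-sized, not formalised here). -/
def CommCriticalBudget (m K : ℕ) : Prop :=
  ∀ (d : Fin K → ℕ) (e : ℕ) (p : Fin K → Fin m → ℝ), StrictMono d → (∀ l i, 0 < p l i) →
    posRoots (critPoly d e p) ≤ 2 * (m - 1) * (K - 1) + 1

/-- **COMM-L1(m,K)** — the located sharp law `OneLawSharp` restricted to positive diagonal letters (`w = 1`):
`Z₊(Π q − X^e Σ_i Π_{j≠i} q j) ≤ 2(m−1)(K−1) + 2`.  Known: `m ≤ 2` (all `K`), `K ≤ 2` (all `m`); first open cell `(3,3)`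
(«COMM(3,3) ≤ 10», Descartes gives `12`). -/
def CommOneLawSharp (m K : ℕ) : Prop :=
  ∀ (d : Fin K → ℕ) (e : ℕ) (p : Fin K → Fin m → ℝ), StrictMono d → (∀ l i, 0 < p l i) →
    posRoots (commDet d e p) ≤ 2 * (m - 1) * (K - 1) + 2

/-- L1's constant is twice the kink budget (memo Thm A: `budget = (m−1)(K−1)+1`; two crossings per maximum). -/
theorem commL1_eq_two_budget (m K : ℕ) : 2 * (m - 1) * (K - 1) + 2 = 2 * ((m - 1) * (K - 1) + 1) := by ring

/-- The tilt is `X · q' − e · q`. -/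
theorem tiltPoly_eq (d : Fin K → ℕ) (e : ℕ) (p : Fin K → Fin m → ℝ) (i : Fin m) :
    tiltPoly d e p i = X * derivative (letterPoly d p i) - C (e : ℝ) * letterPoly d p i := by
  unfold tiltPoly letterPoly
  rw [derivative_sum, Finset.mul_sum, Finset.mul_sum, ← Finset.sum_sub_distrib]
  refine Finset.sum_congr rfl fun l _ => ?_
  rw [derivative_C_mul_X_pow]
  rcases Nat.eq_zero_or_pos (d l) with h | h
  · rw [h]
    simp only [pow_zero, Nat.cast_zero, mul_zero, map_zero, zero_mul, mul_one, mul_zero, zero_sub, map_mul,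
      map_neg, map_natCast]
    ring
  · obtain ⟨k, hk⟩ : ∃ k, d l = k + 1 := ⟨d l - 1, (Nat.succ_pred_eq_of_pos h).symm⟩
    rw [hk, Nat.add_sub_cancel]
    simp only [map_mul, map_sub, map_natCast, Nat.cast_add, Nat.cast_one]
    ring

/-- `m = 0`: no letters, `S = 0`, no roots — the budget holds vacuously-in-content but honestly-in-kernel. -/
theorem commCriticalBudget_zero (K : ℕ) : CommCriticalBudget 0 K := by
  intro d e p _ _
  simp [posRoots, critPoly]

/-! ### Prop. E in kernel (v1.3): `X·(N'·Πq − N·(Πq)') = X^e·S` and, by Rolle, `Z₊(N) ≤ Z₊(S) + 1`;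
hence **CKB ⇒ COMM-L1**.  The algebra uses, for EACH `i`, the factorisation `Πq = q i · Π_{j≠i} q j` — no double sums. -/

/-- `(Σ_i Π_{j≠i} q j) · Π q = Σ_i q i · (Π_{j≠i} q j)²`. -/
theorem sum_coprod_mul_prod (q : Fin m → ℝ[X]) :
    (∑ i, ∏ j ∈ univ.erase i, q j) * ∏ i, q i = ∑ i, q i * (∏ j ∈ univ.erase i, q j) ^ 2 := by
  rw [Finset.sum_mul]
  refine Finset.sum_congr rfl fun i _ => ?_
  rw [← Finset.mul_prod_erase univ q (mem_univ i)]
  ring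

/-- Wronskian identity `T·A' − T'·A = Σ_i (q i)'·(Π_{j≠i} q j)²` for `A = Π q`, `T = Σ_i Π_{j≠i} q j`. -/
theorem sum_coprod_wronskian (q : Fin m → ℝ[X]) :
    (∑ i, ∏ j ∈ univ.erase i, q j) * derivative (∏ i, q i)
      - derivative (∑ i, ∏ j ∈ univ.erase i, q j) * ∏ i, q i
      = ∑ i, derivative (q i) * (∏ j ∈ univ.erase i, q j) ^ 2 := by
  rw [derivative_sum, Finset.sum_mul, Finset.sum_mul, ← Finset.sum_sub_distrib]
  refine Finset.sum_congr rfl fun i _ => ?_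
  have hA : ∏ j, q j = q i * ∏ j ∈ univ.erase i, q j := (Finset.mul_prod_erase univ q (mem_univ i)).symm
  rw [hA, derivative_mul]
  ring

/-- `X · (e · X^{e-1}) = e · X^e` (also for `e = 0`). -/
theorem X_mul_C_mul_X_pow_pred (e : ℕ) : (X : ℝ[X]) * (C (e : ℝ) * X ^ (e - 1)) = C (e : ℝ) * X ^ e := by
  rcases Nat.eq_zero_or_pos e with rfl | he
  · simp
  · obtain ⟨k, rfl⟩ : ∃ k, e = k + 1 := ⟨e - 1, (Nat.succ_pred_eq_of_pos he).symm⟩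
    rw [Nat.add_sub_cancel, pow_succ]
    ring

/-- **Prop. E, algebraic half (memo `negsquares-kink.md` §1):** `X · (N'·Πq − N·(Πq)') = X^e · S`
for `N = commDet`, `S = critPoly` — no positivity needed, an identity in `ℝ[X]`. -/
theorem X_mul_wronskian_commDet (d : Fin K → ℕ) (e : ℕ) (p : Fin K → Fin m → ℝ) :
    X * (derivative (commDet d e p) * ∏ i, letterPoly d p i
        - commDet d e p * derivative (∏ i, letterPoly d p i))
      = X ^ e * critPoly d e p := by
  have h1 := sum_coprod_mul_prod (letterPoly d p)
  have h2 := sum_coprod_wronskian (letterPoly d p)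
  have h5 := X_mul_C_mul_X_pow_pred e
  have h3 : critPoly d e p
      = X * ∑ i, derivative (letterPoly d p i) * (∏ j ∈ univ.erase i, letterPoly d p j) ^ 2
        - C (e : ℝ) * ∑ i, letterPoly d p i * (∏ j ∈ univ.erase i, letterPoly d p j) ^ 2 := by
    simp only [critPoly, tiltPoly_eq, Finset.mul_sum, ← Finset.sum_sub_distrib, Finset.prod_pow]
    refine Finset.sum_congr rfl fun i _ => ?_
    ring
  have h4 : derivative (commDet d e p)
      = derivative (∏ i, letterPoly d p i)
        - (C (e : ℝ) * X ^ (e - 1) * ∑ i, ∏ j ∈ univ.erase i, letterPoly d p j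
            + X ^ e * derivative (∑ i, ∏ j ∈ univ.erase i, letterPoly d p j)) := by
    unfold commDet
    rw [derivative_sub, derivative_mul, derivative_X_pow]
  rw [h3, h4]
  unfold commDet
  linear_combination (-(C (e : ℝ) * X ^ e)) * h1 + X ^ (e + 1) * h2
    + (-((∑ i, ∏ j ∈ univ.erase i, letterPoly d p j) * ∏ i, letterPoly d p i)) * h5

/-- **Prop. E (memo §1), analytic half — Rolle.**  If the product of the letters is positive on `(0,∞)` then
`Z₊(N) ≤ Z₊(S) + 1` (distinct positive roots; the case `S = 0` is handled: then `N/Πq` is constant on `(0,∞)`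
and a nonzero `N` has no positive root). -/
theorem posRoots_commDet_le_succ (d : Fin K → ℕ) (e : ℕ) (p : Fin K → Fin m → ℝ)
    (hA : ∀ t : ℝ, 0 < t → 0 < (∏ i, letterPoly d p i).eval t) :
    posRoots (commDet d e p) ≤ posRoots (critPoly d e p) + 1 := by
  classical
  have hid := X_mul_wronskian_commDet d e p
  set N := commDet d e p with hN_def
  set A := ∏ i, letterPoly d p i with hA_def
  set S := critPoly d e p with hS_def
  have hf : ∀ t : ℝ, 0 < t → HasDerivAt (fun u => N.eval u / A.eval u)
      ((N.derivative.eval t * A.eval t - N.eval t * A.derivative.eval t) / (A.eval t) ^ 2) t :=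
    fun t ht => (N.hasDerivAt t).div (A.hasDerivAt t) (hA t ht).ne'
  have hcont : ∀ a b : ℝ, 0 < a → ContinuousOn (fun u => N.eval u / A.eval u) (Set.Icc a b) :=
    fun a b ha => N.continuousOn.div A.continuousOn fun u hu => (hA u (ha.trans_le hu.1)).ne'
  have key : ∀ c : ℝ, 0 < c →
      N.derivative.eval c * A.eval c - N.eval c * A.derivative.eval c = 0 → S.eval c = 0 := by
    intro c hc h
    have h2 := congrArg (eval c) hid
    simp only [eval_mul, eval_X, eval_sub, eval_pow, h, mul_zero] at h2
    exact (mul_eq_zero.mp h2.symm).resolve_left (pow_ne_zero _ hc.ne')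
  by_cases hN : N = 0
  · simp [posRoots, hN]
  by_cases hS : S = 0
  · have hW : derivative N * A - N * derivative A = 0 := by
      have h0 : (X : ℝ[X]) * (derivative N * A - N * derivative A) = 0 := by rw [hid, hS, mul_zero]
      exact (mul_eq_zero.mp h0).resolve_left X_ne_zero
    have hf0 : ∀ t : ℝ, 0 < t → HasDerivAt (fun u => N.eval u / A.eval u) 0 t := by
      intro t ht
      have hWt : N.derivative.eval t * A.eval t - N.eval t * A.derivative.eval t = 0 := by
        have := congrArg (eval t) hW
        simpa only [eval_sub, eval_mul, eval_zero] using this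
      have := hf t ht
      rwa [hWt, zero_div] at this
    have hnoroot : ∀ x : ℝ, 0 < x → N.eval x = 0 → ∀ u : ℝ, 0 < u → N.eval u = 0 := by
      intro x hx hxr u hu
      have hfx : N.eval x / A.eval x = 0 := by rw [hxr, zero_div]
      have hfu : N.eval u / A.eval u = 0 := by
        rcases le_total x u with hxu | hux
        · have hc := constant_of_has_deriv_right_zero (hcont x u hx)
            (fun t ht => (hf0 t (hx.trans_le ht.1)).hasDerivWithinAt) u ⟨hxu, le_rfl⟩
          rw [hc, hfx]
        · have hc := constant_of_has_deriv_right_zero (hcont u x hu)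
            (fun t ht => (hf0 t (hu.trans_le ht.1)).hasDerivWithinAt) x ⟨hux, le_rfl⟩
          rw [← hc, hfx]
      rcases div_eq_zero_iff.mp hfu with h | h
      · exact h
      · exact absurd h (hA u hu).ne'
    have hempty : (N.roots.toFinset.filter fun t => 0 < t) = ∅ := by
      refine Finset.filter_eq_empty_iff.mpr fun x hx hx0 => hN ?_
      rw [Multiset.mem_toFinset, mem_roots hN] at hx
      refine Polynomial.eq_zero_of_infinite_isRoot N ((Set.Ioi_infinite (0 : ℝ)).mono fun u hu => ?_)
      exact hnoroot x hx0 hx u hu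
    simp [posRoots, hempty]
  · refine Finset.card_le_of_interleaved fun x hx y hy hxy _ => ?_
    simp only [Finset.mem_filter, Multiset.mem_toFinset, mem_roots hN, IsRoot.def] at hx hy
    obtain ⟨c, hc, hc'⟩ := exists_deriv_eq_zero (f := fun u => N.eval u / A.eval u) hxy (hcont x y hx.2)
      (by rw [hx.1, hy.1, zero_div, zero_div])
    have hc0 : 0 < c := hx.2.trans hc.1
    refine ⟨c, ?_, hc.1, hc.2⟩
    simp only [Finset.mem_filter, Multiset.mem_toFinset, mem_roots hS, IsRoot.def]
    refine ⟨key c hc0 ?_, hc0⟩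
    have hd := (hf c hc0).deriv
    rw [hc'] at hd
    rcases div_eq_zero_iff.mp hd.symm with h | h
    · exact h
    · exact absurd (pow_eq_zero_iff two_ne_zero |>.mp h) (hA c hc0).ne'

/-- Positive letters have a positive product on `(0,∞)` (needs `K ≥ 1`; for `K = 0` every letter is `0`). -/
theorem prod_letterPoly_eval_pos (d : Fin K → ℕ) (p : Fin K → Fin m → ℝ) (hK : 0 < K)
    (hp : ∀ l i, 0 < p l i) {t : ℝ} (ht : 0 < t) : 0 < (∏ i, letterPoly d p i).eval t := by
  rw [eval_prod]
  refine Finset.prod_pos fun i _ => ?_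
  simp only [letterPoly, eval_finsetSum, eval_mul, eval_C, eval_pow, eval_X]
  haveI : Nonempty (Fin K) := ⟨⟨0, hK⟩⟩
  exact Finset.sum_pos (fun l _ => mul_pos (hp l i) (pow_pos ht _)) Finset.univ_nonempty

/-- **CKB ⇒ COMM-L1 (memo Prop. E, in kernel): the commuting located one-law follows from the critical budget**
(`K ≥ 1`; `K = 0` has no letters).  In particular `CommCriticalBudget 3 3` («`Z₊(S) ≤ 9`») gives COMM(3,3) `≤ 10`. -/
theorem commOneLawSharp_of_commCriticalBudget (hK : 0 < K) (h : CommCriticalBudget m K) :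
    CommOneLawSharp m K := by
  intro d e p hd hp
  have h1 := posRoots_commDet_le_succ d e p fun t ht => prod_letterPoly_eval_pos d p hK hp ht
  have h2 := h d e p hd hp
  omega

end Commuting

end Summit.ValiantsHypothesis.ValiantsHypothesis.Theorems.LacunarySymmetroidMatrixDescartes.NegSquaresTropical
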